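import Mathlib.Data.Fintype.Basic
import Mathlib.Algebra.BigOperators.Group.Finset.Basic
import HarnessLib

/-!
# Cell qa-qnc0 — the finite certificate behind the SCATTERED gap law for `k = 3`
(planner qa-qnc0-p2 g17 `line17/Sketch17.lean` §5: `GapLawScatteredThree`, kit j298599 `M_3 = 7/8`)

On a fibre of three unread coordinates the win parity is `Σ_{j<4, ρ<3} n_{jρ}·[ρ + |t| + |t|_{<j} ≢ 0 (mod 3)] (mod 2)`
for the `12` parity bits `n_{jρ}` of the configuration (`j` = number of unread coordinates before the cut, `ρ` = charge offset).
**`scat_exists_even`**: for every configuration some `t ∈ {0,1}³` makes it even (so one of the `8` inputs of the fibre loses).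
Kernel-checked by `decide` in `16` chunks of `2^8` configurations.

WHAT THIS IS NOT: the reduction from strategies to configurations is in `ScatteredGap.lean`; no claim for `k ≠ 3`.
-/

namespace Summit.QuantumAdvantage.AdviceFreeQNC0

namespace ScatteredGap

/-- `|t|_{<j}` for `j ≤ 3`. -/
def psum (t0 t1 t2 : Bool) : ℕ → ℕ
  | 0 => 0
  | 1 => t0.toNat
  | 2 => t0.toNat + t1.toNat
  | _ => t0.toNat + t1.toNat + t2.toNat

/-- One term of the win count: group `j`, offset `ρ`. -/
def term (nb : Bool) (j ρ : ℕ) (t0 t1 t2 : Bool) : ℕ :=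
  if nb ∧ (ρ + (t0.toNat + t1.toNat + t2.toNat) + psum t0 t1 t2 j) % 3 ≠ 0 then 1 else 0

/-- The win count of the configuration `(n_{jρ})` at the fibre point `t`. -/
def cnt (n00 n01 n02 n10 n11 n12 n20 n21 n22 n30 n31 n32 : Bool) (t0 t1 t2 : Bool) : ℕ :=
  term n00 0 0 t0 t1 t2 + term n01 0 1 t0 t1 t2 + term n02 0 2 t0 t1 t2 +
  term n10 1 0 t0 t1 t2 + term n11 1 1 t0 t1 t2 + term n12 1 2 t0 t1 t2 +
  term n20 2 0 t0 t1 t2 + term n21 2 1 t0 t1 t2 + term n22 2 2 t0 t1 t2 +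
  term n30 3 0 t0 t1 t2 + term n31 3 1 t0 t1 t2 + term n32 3 2 t0 t1 t2

/-- Some fibre point has an even count (Boolean form). -/
def ok (n00 n01 n02 n10 n11 n12 n20 n21 n22 n30 n31 n32 : Bool) : Bool :=
  [false, true].any fun t0 => [false, true].any fun t1 => [false, true].any fun t2 =>
    cnt n00 n01 n02 n10 n11 n12 n20 n21 n22 n30 n31 n32 t0 t1 t2 % 2 == 0

/-- Chunk `n00 n01 n02 n10 = ffff … tttt`: all sixteen by `decide`. -/
theorem ok_chunk (n00 n01 n02 n10 : Bool) : ∀ n11 n12 n20 n21 n22 n30 n31 n32 : Bool,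
    ok n00 n01 n02 n10 n11 n12 n20 n21 n22 n30 n31 n32 = true := by
  cases n00 <;> cases n01 <;> cases n02 <;> cases n10 <;> decide

/-- **The certificate**: every configuration has a fibre point with even win count. -/
theorem scat_exists_even (n00 n01 n02 n10 n11 n12 n20 n21 n22 n30 n31 n32 : Bool) :
    ∃ t0 t1 t2 : Bool, cnt n00 n01 n02 n10 n11 n12 n20 n21 n22 n30 n31 n32 t0 t1 t2 % 2 = 0 := by
  have h := ok_chunk n00 n01 n02 n10 n11 n12 n20 n21 n22 n30 n31 n32
  unfold ok at h
  simp only [List.any_cons, List.any_nil, Bool.or_false, Bool.or_eq_true, beq_iff_eq] at h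
  rcases h with ((h | h) | (h | h)) | ((h | h) | (h | h))
  · exact ⟨false, false, false, h⟩
  · exact ⟨false, false, true, h⟩
  · exact ⟨false, true, false, h⟩
  · exact ⟨false, true, true, h⟩
  · exact ⟨true, false, false, h⟩
  · exact ⟨true, false, true, h⟩
  · exact ⟨true, true, false, h⟩
  · exact ⟨true, true, true, h⟩

end ScatteredGap

end Summit.QuantumAdvantage.AdviceFreeQNC0
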